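import Literature.Probability.RandomPlanarGeometry.SAWWords
import Std.Data.HashMap
import HarnessLib

/-!
# A transfer matrix for irreducible bridges of given span in a strip (definitions)

Topic `Literature/Probability/RandomPlanarGeometry`. Executable definitions of the frontier
("signature") transfer matrix used for the certified LOWER bound on `μ(ℤ²)` by Kesten's method
with span-limited irreducible bridges (Alm–Parviainen 2004; Jensen 2004, §2.1: "transfer-matrix
techniques to exactly enumerate the number of bridges of a given span"). Soundness (every accepted
trace decodes to a distinct irreducible bridge) is proved in `SAWStripTMSound*.lean`; the
compiled evaluations are in `SAWStripTMEval.lean`.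

## The automaton

The grid has columns `0 ≤ c < l` (first coordinates `1, …, l` of the bridge; its start `x = 0` is
the virtual source, attached to the start cell `(0, r₀)` by the first `+e₀` step) and rows
`0 ≤ r < H`. Cells are swept row by row; the frontier keeps, for every column, a `Code`:
`empty` (degree 0), `inter` (degree 2, or the dummy below row 0), or `stop m` (degree 1: an end of
a partial strand whose other end is the frontier cell of column `k` (`m = col k`), the virtual
source (`src`) or the virtual sink (`snk`)). For the cell `v = (c, r)` two **micro-steps** are
read from the trace (a `List Bool`): `advance` (vertical edge `(c, r-1)—v`?, then `(c, r-1)`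
retires: with degree 1 only as the END of the bridge, in the last column) and `joinH` (horizontal
edge `(c-1, r)—v`?, with cycle detection through the mates and completion when the source strand
meets the sink strand). `gaps` counts (capped at 2) the horizontal edges across each internal
column gap: completion requires all of them `≥ 2` (irreducibility, `isIrreducible_of_crossings`).
The weight of a partial trace with `e` edges is `(5/13)^e` (fugacity `1/2.6`), carried as the
integer `⌊2⁶⁴ (5/13)^e⌋` (rounding down is sound for a lower bound); a completed trace contributes
one more factor `5/13` for the initial step.

## References

* I. Jensen, *Improved lower bounds on the connective constants for two-dimensional self-avoiding
  walks*, J. Phys. A 37 (2004) 11521–11529, §2.1.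
* S. E. Alm, R. Parviainen, *Bounds for the connective constant of the hexagonal lattice*,
  J. Phys. A 37 (2004) 549–560.
* D. E. Knuth, *The Art of Computer Programming* 4A, §7.1.4 (frontier/"mate" encodings of
  simple paths, `SIMPATH`).
-/

namespace Literature.Probability.RandomPlanarGeometry.SAW

namespace StripTM

/-! ### Signatures -/

/-- The far end of a partial strand seen from one of its ends: the frontier cell of column `k`,
the virtual source, or the virtual sink. [cite: Jensen2004SAWLowerBounds, §2.1] -/
inductive Mate
  | col (k : ℕ)
  | src
  | snk
  deriving DecidableEq, Hashable, Repr

/-- The code of a frontier cell: unused, closed (degree 2 or dummy), or a strand end with its mate.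
[cite: Jensen2004SAWLowerBounds, §2.1] -/
inductive Code
  | empty
  | inter
  | stop (m : Mate)
  deriving DecidableEq, Hashable, Repr

/-- A signature: the codes of the `l` frontier cells, the capped crossing counts of the `l - 1`
internal column gaps, and whether the sink (end of the bridge) has been placed.
[cite: Jensen2004SAWLowerBounds, §2.1] -/
structure State where
  /-- codes of the frontier cells, by column -/
  slots : List Code
  /-- `min 2 (number of horizontal edges across the gap {k, k+1})`, by `k` -/
  gaps : List ℕ
  /-- the end vertex of the bridge has been placed -/
  sink : Bool
  deriving DecidableEq, Hashable, Repr

/-- Result of a micro-step. [folklore] -/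
inductive Res
  | dead
  | complete
  | next (σ : State)
  deriving DecidableEq

/-- `Code.isOpen`: the cell can take no further edge iff it is `inter`; `empty` and `inter` are
the codes without a pending strand end. [folklore] -/
def Code.noEnd : Code → Bool
  | .stop _ => false
  | _ => true

/-- All slots except those in `ex` carry no strand end. [folklore] -/
def othersClosed (slots : List Code) (ex : List ℕ) : Bool :=
  (slots.zipIdx.all fun p => ex.contains p.2 || p.1.noEnd)

/-- All internal gaps have been crossed at least twice. [folklore] -/
def gapsOK (gaps : List ℕ) : Bool := gaps.all fun g => decide (2 ≤ g)

/-- Increment (capped at 2) the crossing count of gap `k`. [folklore] -/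
def bump (gaps : List ℕ) (k : ℕ) : List ℕ := gaps.modify k fun g => min 2 (g + 1)

/-- Completion test. [folklore] -/
def completeIf (b : Bool) (gaps : List ℕ) : Res := if b && gapsOK gaps then .complete else .dead

/-- Retarget the far end `m` of a strand (if it is a frontier cell) to the new mate `m'`.
[folklore] -/
def retarget (slots : List Code) (m : Mate) (m' : Mate) : List Code :=
  match m with
  | .col k => slots.set k (.stop m')
  | _ => slots

variable (l H r0 : ℕ)

/-- The cell swept at cell-time `t` is the start cell `(0, r₀)`. [folklore] -/
def isStart (t : ℕ) : Bool := decide (t % l = 0 ∧ t / l = r0)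

/-- **Micro-step `advance`** at cell-time `t` (cell `v = (t % l, t / l)`): decide the vertical edge
from the cell below (`e`), then retire the cell below. [cite: Jensen2004SAWLowerBounds, §2.1] -/
def advance (t : ℕ) (σ : State) (e : Bool) : Res :=
  let c := t % l
  let st := isStart l r0 t
  let vInit : Code := if st then .stop .src else .empty
  match σ.slots[c]?.getD .inter, e with
  | .inter, true => .dead
  | .empty, true =>
      -- new strand `[below, v]`; the cell below retires with degree 1: it must be the sink
      if c + 1 = l ∧ σ.sink = false ∧ st = false then
        .next { σ with slots := σ.slots.set c (.stop .snk), sink := true }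
      else .dead
  | .stop m, true =>
      -- `v` extends the strand ending below it (same far end `m`)
      if st then
        -- `v` is the start cell: the source attaches too, `v` is closed, the far end sees `src`
        match m with
        | .snk => completeIf (othersClosed σ.slots [c]) σ.gaps
        | .src => .dead
        | .col k => .next { σ with slots := (σ.slots.set c .inter).set k (.stop .src) }
      else .next σ
  | .empty, false => .next { σ with slots := σ.slots.set c vInit }
  | .inter, false => .next { σ with slots := σ.slots.set c vInit }
  | .stop m, false =>
      -- the cell below retires with degree 1: it must be the sink
      if c + 1 = l ∧ σ.sink = false then
        match m with
        | .src => completeIf (othersClosed σ.slots [c] && !st) σ.gaps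
        | .snk => .dead
        | .col k => .next { σ with slots := (σ.slots.set k (.stop .snk)).set c vInit, sink := true }
      else .dead

/-- **Micro-step `joinH`** at cell-time `t`: decide the horizontal edge between the frontier cells
of columns `c - 1` and `c` (both in the current row). [cite: Jensen2004SAWLowerBounds, §2.1] -/
def joinH (t : ℕ) (σ : State) (e : Bool) : Res :=
  let c := t % l
  if e = false then .next σ
  else if c = 0 then .dead
  else
    let gaps' := bump σ.gaps (c - 1)
    match σ.slots[c - 1]?.getD .inter, σ.slots[c]?.getD .inter with
    | .inter, _ => .dead
    | _, .inter => .dead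
    | .empty, .empty =>
        .next { σ with slots := (σ.slots.set (c - 1) (.stop (.col c))).set c (.stop (.col (c - 1))),
                       gaps := gaps' }
    | .empty, .stop mb =>
        .next { σ with slots := retarget ((σ.slots.set (c - 1) (.stop mb)).set c .inter) mb (.col (c - 1)),
                       gaps := gaps' }
    | .stop ma, .empty =>
        .next { σ with slots := retarget ((σ.slots.set c (.stop ma)).set (c - 1) .inter) ma (.col c),
                       gaps := gaps' }
    | .stop ma, .stop mb =>
        if ma = .col c ∨ mb = .col (c - 1) then .dead
        else if (ma = .src ∧ mb = .snk) ∨ (ma = .snk ∧ mb = .src) then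
          completeIf (othersClosed σ.slots [c - 1, c]) gaps'
        else
          .next { σ with
            slots := retarget (retarget ((σ.slots.set (c - 1) .inter).set c .inter) ma mb) mb ma,
            gaps := gaps' }

/-- The micro-step number `u`: `advance` of cell `u / 2` for even `u`, `joinH` for odd `u`.
[cite: Jensen2004SAWLowerBounds, §2.1] -/
def step (u : ℕ) (σ : State) (e : Bool) : Res :=
  if u % 2 = 0 then advance l r0 (u / 2) σ e else joinH l (u / 2) σ e

/-- The initial signature: dummies below row 0, no crossings, no sink. [folklore] -/
def initState : State := ⟨List.replicate l .inter, List.replicate (l - 1) 0, false⟩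

/-! ### The weighted count (fixed-point arithmetic, rounded down) -/

/-- The fixed-point scale `2⁶⁴`. [folklore] -/
def SCALE : ℕ := 2 ^ 64

/-- Multiply a fixed-point weight by the fugacity `5/13`, rounding down. [folklore] -/
def fug (w : ℕ) : ℕ := w * 5 / 13

/-- Process one (signature, weight) pair for the choice `e` at micro-step `u`: extend the next
layer or add a completed block (with the extra factor `5/13` of the initial step) to the
accumulator. [folklore] -/
def addChoice (u : ℕ) (σ : State) (w : ℕ) (e : Bool) (p : Std.HashMap State ℕ × ℕ) :
    Std.HashMap State ℕ × ℕ :=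
  let w' := if e then fug w else w
  match step l r0 u σ e with
  | .dead => p
  | .complete => (p.1, p.2 + fug w')
  | .next σ' => (p.1.alter σ' fun o => some (o.getD 0 + w'), p.2)

/-- Build the next layer from a list of (signature, weight) pairs. [folklore] -/
def layerOfList (u : ℕ) (entries : List (State × ℕ)) (acc : ℕ) : Std.HashMap State ℕ × ℕ :=
  entries.foldl (fun p sw => addChoice l r0 u sw.1 sw.2 true (addChoice l r0 u sw.1 sw.2 false p))
    (Std.HashMap.emptyWithCapacity 4096, acc)

/-- One micro-step of the weighted count. [folklore] -/
def layer (u : ℕ) (p : Std.HashMap State ℕ × ℕ) : Std.HashMap State ℕ × ℕ :=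
  layerOfList l r0 u p.1.toList p.2

/-- Run the micro-steps `u, u+1, …, u+n-1`. [folklore] -/
def runFrom (u n : ℕ) (p : Std.HashMap State ℕ × ℕ) : Std.HashMap State ℕ × ℕ :=
  match n with
  | 0 => p
  | n + 1 => runFrom (u + 1) n (layer l r0 u p)

/-- **The certified quantity** `dp l H r0`: `2⁶⁴ ×` (a lower bound, by rounding down, of) the sum
of `(5/13)^{|s|}` over the irreducible bridges `s` of span `l` decoded from the accepted traces of
the `l × H` grid with start row `r₀`. Only ever evaluated by `native_decide`. [cite: Jensen2004SAWLowerBounds, §2] -/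
def dp : ℕ :=
  (runFrom l r0 0 (2 * l * H) ((Std.HashMap.emptyWithCapacity 16).insert (initState l) SCALE, 0)).2

end StripTM

end Literature.Probability.RandomPlanarGeometry.SAW
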